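import Summits.CriticalPhenomena.PercolationContinuityZ3.Theorems.PercNearOneGluingNoHeavyQuantShapePieceBlob
import Summits.CriticalPhenomena.PercolationContinuityZ3.Theorems.PercNearOneGluingNoHeavyQuantPieceBlobLongRoute
import HarnessLib

/-!
# QUANT lane R8, T-DEC: THE PIECE BESIDE A BIG BLOB FOR EVERY SHAPE `lo < K ≤ 4lo` AND EVERY GATE — **`sdec_pieceBlob_long`** (census-1 gen 33)

builds on p205010 (kernel theorem, internal audit signed; external expert review pending)

Support file (`--supports stmt-CriticalPhenomena-4575`), QUANT lane seat prim-quant-census-1 (gen 33); memo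
`run/shared/lean/prim/quant/prim-quant-census-1/g33/WIDE3-G33.md` §4.  Theorems only, standard axioms, no sorries.  This file: **`sdec_pieceBlob_long`** — `lo < K ≤ 4lo`, `lo ≤ Kγ`, `γ < 1`, `0 ≤ g < 1`, `2lo ≤ (lo+K)g`, `0 < x ≤ g`, `x(lo+K) ≤ lo+Kγ` ⟹ `SDEC x (2lo+2K) (blob_{lo+K}(g) ∗ S(γ))` (g31's `sdec_pieceBlob` needed `K ≤ 2lo`, `γ ≥ 1/2`); the flow is `f l h = [l = lo]·([h = 2lo+K]·f₁ + [h = 2lo+2K]·f₂)` from `pieceBlobLong_route`.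
THE RULE (memo §4; exact regression `g33/code/exp6_pieceblob_rule.py`, 0 failures on 13 shapes `lo < K ≤ 4lo`): per outer gate, the low atom `lo` of
`S(γ) ∗ blob_{lo+K}(g)` goes to `2lo+K` while `θ₁(ν(lo)+ν(2lo+K)) ≤ ν(2lo+K)` (`θ₁ = max(y, D/(lo+K))`, `D = T − 2lo`); otherwise the flow
SPLITS — `a(1−γ)g(lo+K−D)/D` saturates `2lo+K`, the overflow `a(1−γ)(D−(lo+K)g)/D` goes to the top; for `D ≥ lo+K` everything goes to the top.
Bricks (polynomial inequalities in `lo, K, γ, g, D` (and `y`/`x`), K-units `c = lo/K ∈ [1/4, 1]` split into the boxes `[1/4,1/3]`, `[1/3,1/2]`, `[1/2,1]`):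
PB1/PB2 (top capacity of the overflow: ρ / floor), PC1a–c / PC2a–c (split cost: ρ / floor regime, three budget sub-cases), PD1/PD2 (top capacity,
regime II), PE1/PE2 (top cost, regime II); the floor-regime bricks are certified at the floor bound `ȳ = (2lo+D)·x_max/T₀` (`…GD` / `…XD` for
`x_max = g` / `(lo+Kγ)/(lo+K)`) and transported to every `y ≤ ȳ` by monotonicity (`pb_glue_cap`, `pb_glue_cost`).  Certificates: Handelman products found
by kit (`g33/code/kitjob6`: scipy/HiGHS dual simplex for the support + exact rational repair), checked here by `linarith`.

HONEST STATUS.  A core lemma (the `|S| = 1` term of the piece expansion for long tails); with the hubs of widths 2, 3 (`sdec_sHub_two_all`, `sdec_sHub_three_upTo4`) the ≤ 3-sibling long-tail forest theorem is within reach of `shapeForest_inv`.  `SiblingStep`, `GluedDominatedMass`, `SDECConvClosed`, `FarTreeRow` OPEN; RATE class (log\*) / honest sentence of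
`run/shared/lean/prim/quant/README.md` unchanged.  [this work].  Nothing here is cited as a published result.  The gluing rows served
[cite: KozmaNitzan2024, Conjecture 3 (p. 15)]; product measure [cite: Grimmett1999, §1.3 p. 10].
-/

noncomputable section

open scoped BigOperators

namespace Summit.CriticalPhenomena.PercolationContinuityZ3.Theorems
namespace Quant
namespace LawDec

/-- the point mass `δ_K` -/
local notation3 "δ[" K "]" => (fun k : ℕ => if k = (K : ℕ) then (1 : ℝ) else 0)

/-- the FAR-GIANT PIECE of shape `(lo, K)`: `S(γ) = {lo: 1−γ, lo+K: γ}` -/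
local notation3 "SP[" lo ", " K ", " a "]" => (fun h : ℕ => (1 - (a : ℝ)) * (if h = (lo : ℕ) then (1 : ℝ) else 0) +
  (a : ℝ) * (if h = (lo : ℕ) + (K : ℕ) then (1 : ℝ) else 0))

/-- **THE PIECE BESIDE A BIG HEAVY BLOB IS SDEC FOR EVERY SHAPE `lo < K ≤ 4lo` AND EVERY GATE `γ ≥ lo/K`.**  For `lo ≤ Kγ`, `γ < 1`, `0 ≤ g < 1`,
`2lo ≤ (lo+K)g`, `0 < x ≤ g`, `x(lo+K) ≤ lo + Kγ`: `SDEC x (2lo+2K) (blob_{lo+K}(g) ∗ S(γ))`. [this work] -/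
theorem sdec_pieceBlob_long (lo K : ℕ) (hloK : lo < K) (hK4 : K ≤ 4 * lo) {x γ g : ℝ} (hx0 : 0 < x) (hγ : (lo : ℝ) ≤ K * γ) (hγ1 : γ < 1)
    (hg0 : 0 ≤ g) (hg1 : g < 1) (hbig : 2 * (lo : ℝ) ≤ ((lo : ℝ) + K) * g) (hxg : x ≤ g) (hxP : x * ((lo : ℝ) + K) ≤ lo + K * γ) :
    SDEC x (2 * lo + 2 * K) (lconv (lo + K) (lo + K) (gate δ[lo + K] g) SP[lo, K, γ]) := by
  have hlo : 1 ≤ lo := by omega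
  have hloR : (1 : ℝ) ≤ lo := by exact_mod_cast hlo
  have hKR : (lo : ℝ) < K := by exact_mod_cast hloK
  have hK0 : (0 : ℝ) < K := by linarith
  have hx1 : x < 1 := lt_of_le_of_lt hxg hg1
  have pγ : (0 : ℝ) ≤ γ := by
    by_contra hc; push Not at hc; have := mul_neg_of_pos_of_neg hK0 hc; linarith
  have nγ : (0 : ℝ) ≤ 1 - γ := by linarith
  have ng : (0 : ℝ) ≤ 1 - g := by linarith
  have u1n : 0 ≤ (1 - γ) * (1 - g) := mul_nonneg nγ ng
  set P : ℝ := (lo : ℝ) + K * γ with hP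
  set Q : ℝ := ((lo : ℝ) + K) * g with hQ
  -- the blob and the piece
  set GD : ℕ → ℝ := gate δ[lo + K] g with hGD
  have GDv : ∀ k, GD k = g * (if k = lo + K then (1 : ℝ) else 0) + (1 - g) * (if k = 0 then (1 : ℝ) else 0) := fun k => by
    rw [hGD, gate_apply]
  have hF : ∀ i, lo + K < i → GD i = 0 := fun i hi => by
    rw [GDv, if_neg (by omega), if_neg (by omega)]; ring
  have d0 : ∀ h, 0 ≤ δ[lo + K] h := fun h => by dsimp only; split_ifs <;> norm_num
  have dM : ∀ h, lo + K < h → δ[lo + K] h = 0 := fun h hh => by dsimp only; rw [if_neg (by omega)]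
  have d1 : ∑ h ∈ Finset.range (lo + K + 1), δ[lo + K] h = 1 := by
    rw [Finset.sum_ite_eq']; rw [if_pos (Finset.mem_range.2 (by omega))]
  obtain ⟨b0, _, b1⟩ := gate_laws (lo + K) δ[lo + K] g hg0 hg1.le d0 dM d1
  have bm : ∑ h ∈ Finset.range (lo + K + 1), (h : ℝ) * GD h = Q := by
    rw [hGD, sum_mul_gate]
    have : ∑ h ∈ Finset.range (lo + K + 1), (h : ℝ) * δ[lo + K] h = (lo : ℝ) + K := by
      have e : ∀ h : ℕ, (h : ℝ) * δ[lo + K] h = (if h = lo + K then ((lo + K : ℕ) : ℝ) else 0) := by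
        intro h; dsimp only; split_ifs with hh
        · rw [hh, mul_one]
        · rw [mul_zero]
      simp only [e, Finset.sum_ite_eq', Finset.mem_range]
      rw [if_pos (by omega)]; push_cast; ring
    rw [this, hQ]; ring
  have c0 : ∀ h, 0 ≤ SP[lo, K, γ] h := fun h => by
    dsimp only; split_ifs <;> nlinarith
  have c1 : ∑ h ∈ Finset.range (lo + K + 1), SP[lo, K, γ] h = 1 := by
    simp only [Finset.sum_add_distrib, ← Finset.mul_sum, Finset.sum_ite_eq', Finset.mem_range]
    rw [if_pos (by omega), if_pos (by omega)]; ring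
  have cm : ∑ h ∈ Finset.range (lo + K + 1), (h : ℝ) * SP[lo, K, γ] h = P := by
    have e : ∀ h : ℕ, (h : ℝ) * SP[lo, K, γ] h
        = (1 - γ) * (if h = lo then ((lo : ℕ) : ℝ) else 0) + γ * (if h = lo + K then (((lo + K : ℕ)) : ℝ) else 0) := by
      intro h; dsimp only
      by_cases h1 : h = lo
      · rw [if_pos h1, if_neg (show ¬ (h = lo + K) by omega), if_pos h1, if_neg (show ¬ (h = lo + K) by omega), h1]; ring
      · by_cases h2 : h = lo + K
        · rw [if_neg h1, if_pos h2, if_neg h1, if_pos h2, h2]; ring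
        · rw [if_neg h1, if_neg h2, if_neg h1, if_neg h2]; ring
    simp only [e, Finset.sum_add_distrib, ← Finset.mul_sum, Finset.sum_ite_eq', Finset.mem_range]
    rw [if_pos (by omega), if_pos (by omega), hP]; push_cast; ring
  obtain ⟨l0, lM', l1', lmean'⟩ := lconv_laws b0 b1 bm c0 c1 cm
  set L : ℕ → ℝ := lconv (lo + K) (lo + K) GD SP[lo, K, γ] with hL
  have eM : lo + K + (lo + K) = 2 * lo + 2 * K := by ring
  have lM : ∀ h, 2 * lo + 2 * K < h → L h = 0 := fun h hh => lM' h (by omega)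
  have l1 : ∑ h ∈ Finset.range (2 * lo + 2 * K + 1), L h = 1 := by rw [← eM]; exact l1'
  have lmean : ∑ h ∈ Finset.range (2 * lo + 2 * K + 1), (h : ℝ) * L h = P + Q := by rw [← eM, lmean']; ring
  have Lv : ∀ h, L h = (1 - γ) * (if lo ≤ h then GD (h - lo) else 0) + γ * (if lo + K ≤ h then GD (h - (lo + K)) else 0) :=
    fun h => lconv_sp_apply lo K (lo + K) GD γ hF h
  have vlo : L lo = (1 - γ) * (1 - g) := by
    rw [Lv, if_pos le_rfl, if_neg (show ¬ (lo + K ≤ lo) by omega), Nat.sub_self, GDv 0, if_neg (show (0 : ℕ) ≠ lo + K by omega),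
      if_pos rfl]; ring
  have vmid : L (lo + K) = γ * (1 - g) := by
    rw [Lv, if_pos (show lo ≤ lo + K by omega), if_pos le_rfl, show lo + K - lo = K by omega, Nat.sub_self, GDv K, GDv 0,
      if_neg (show K ≠ lo + K by omega), if_neg (show K ≠ 0 by omega), if_neg (show (0 : ℕ) ≠ lo + K by omega), if_pos rfl]; ring
  have vh1 : L (2 * lo + K) = (1 - γ) * g := by
    rw [Lv, if_pos (show lo ≤ 2 * lo + K by omega), if_pos (show lo + K ≤ 2 * lo + K by omega), show 2 * lo + K - lo = lo + K by omega,
      show 2 * lo + K - (lo + K) = lo by omega, GDv (lo + K), GDv lo, if_pos rfl, if_neg (show lo + K ≠ 0 by omega),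
      if_neg (show lo ≠ lo + K by omega), if_neg (show lo ≠ 0 by omega)]; ring
  have vtop : L (2 * lo + 2 * K) = γ * g := by
    rw [Lv, if_pos (show lo ≤ 2 * lo + 2 * K by omega), if_pos (show lo + K ≤ 2 * lo + 2 * K by omega),
      show 2 * lo + 2 * K - lo = lo + 2 * K by omega, show 2 * lo + 2 * K - (lo + K) = lo + K by omega, GDv (lo + 2 * K), GDv (lo + K),
      if_neg (show lo + 2 * K ≠ lo + K by omega), if_neg (show lo + 2 * K ≠ 0 by omega), if_pos rfl, if_neg (show lo + K ≠ 0 by omega)]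
    ring
  have vlow : ∀ l, l < lo + K → l ≠ lo → L l = 0 := by
    intro l hl hne
    rw [Lv, if_neg (show ¬ (lo + K ≤ l) by omega)]
    by_cases hll : lo ≤ l
    · rw [if_pos hll, GDv (l - lo), if_neg (show l - lo ≠ lo + K by omega), if_neg (show l - lo ≠ 0 by omega)]; ring
    · rw [if_neg hll]; ring
  clear_value GD L
  have hB0 : (0 : ℝ) < (lo : ℝ) + K := by linarith
  have hT0pos : 0 < P + Q := by
    have : 0 ≤ (K : ℝ) * γ := mul_nonneg hK0.le pγ
    have : 0 ≤ Q := by rw [hQ]; exact mul_nonneg hB0.le hg0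
    rw [hP]; linarith
  intro a ha0 ha1 j' hj'
  obtain ⟨g0, gM, g1⟩ := gate_laws (2 * lo + 2 * K) L a ha0.le ha1 l0 lM l1
  have gmean : ∑ h ∈ Finset.range (2 * lo + 2 * K + 1), (h : ℝ) * gate L a h = a * (P + Q) := by
    rw [sum_mul_gate, lmean]
  have gv : ∀ h, h ≠ 0 → gate L a h = a * L h := fun h hh => by
    rw [gate_apply, if_neg hh, mul_zero, add_zero]
  set T : ℝ := a * (P + Q) with hT
  have hax0 : 0 < a * x := mul_pos ha0 hx0
  have haxx : a * x ≤ x := by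
    have := mul_le_mul_of_nonneg_right ha1 hx0.le
    rwa [one_mul] at this
  have hax1 : a * x < 1 := by linarith
  have hT0 : 0 < T := mul_pos ha0 hT0pos
  have hTle : T ≤ P + Q := by
    have := mul_le_mul_of_nonneg_right ha1 hT0pos.le
    rwa [one_mul] at this
  have hP1 : P < (lo : ℝ) + K := by
    have := mul_lt_mul_of_pos_left hγ1 hK0
    rw [hP]; linarith only [this]
  have hQ1 : Q < (lo : ℝ) + K := by
    have := mul_lt_mul_of_pos_left hg1 hB0
    rw [hQ]; linarith only [this]
  have hTtop : T < 2 * (lo : ℝ) + 2 * K := by linarith only [hTle, hP1, hQ1]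
  have hxQ : x * ((lo : ℝ) + K) ≤ Q := by
    rw [hQ, mul_comm ((lo : ℝ) + K) g]; exact mul_le_mul_of_nonneg_right hxg hB0.le
  have hxT2 : a * x * ((lo : ℝ) + K) ≤ T / 2 := by
    have h2 : 2 * (x * ((lo : ℝ) + K)) ≤ P + Q := by linarith
    have := mul_le_mul_of_nonneg_left h2 ha0.le
    have e : a * (2 * (x * ((lo : ℝ) + K))) = 2 * (a * x * ((lo : ℝ) + K)) := by ring
    rw [e] at this
    linarith
  have hta : a * x * ((2 * lo + 2 * K : ℕ) : ℝ) ≤ T := by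
    push_cast
    have e : a * x * (2 * (lo : ℝ) + 2 * K) = 2 * (a * x * ((lo : ℝ) + K)) := by ring
    rw [e]; linarith
  have v1 : gate L a lo = a * ((1 - γ) * (1 - g)) := by rw [gv lo (by omega), vlo]
  have v2 : gate L a (lo + K) = a * (γ * (1 - g)) := by rw [gv _ (by omega), vmid]
  have v3 : gate L a (2 * lo + K) = a * ((1 - γ) * g) := by rw [gv _ (by omega), vh1]
  have v4 : gate L a (2 * lo + 2 * K) = a * (γ * g) := by rw [gv _ (by omega), vtop]
  -- positive lows other than `lo` are uncharged
  have lowz : ∀ l : ℕ, 1 ≤ l → 2 * (l : ℝ) < T → l ≠ lo → gate L a l = 0 := by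
    intro l hl hlow hne
    rw [gv l (by omega)]
    have hlK : l < lo + K := by
      have : (l : ℝ) < (lo : ℝ) + K := by linarith
      exact_mod_cast this
    rw [vlow l hlK hne, mul_zero]
  by_cases hT2 : 2 * (lo : ℝ) < T
  · obtain ⟨f₁, f₂, hf₁, hf₂, hsum, hcomp₁, hcap₁, hcap₂, hcost⟩ := pieceBlobLong_route lo K hlo hloK hK4 (gate L a) (a * x) T γ g a x g0 hx0 hxg hxP
      ha0 ha1 rfl hγ hγ1 hbig hg1 (by rw [hT, hP, hQ]) hT2 v1 v2 v3 v4
    have hne : 2 * lo + K ≠ 2 * lo + 2 * K := by omega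
    set h₁ : ℕ := 2 * lo + K with hh₁
    set M : ℕ := 2 * lo + 2 * K with hM
    have cMR : ((M : ℕ) : ℝ) = 2 * (lo : ℝ) + 2 * K := by rw [hM]; push_cast; ring
    -- the one-row, two-column flow
    set f : ℕ → ℕ → ℝ := fun l h => if l = lo then (if h = h₁ then f₁ else if h = M then f₂ else 0) else 0 with hf
    have fv : ∀ h, f lo h = (if h = h₁ then f₁ else if h = M then f₂ else 0) := fun h => by rw [hf]; dsimp only; rw [if_pos rfl]
    have fz : ∀ l h, l ≠ lo → f l h = 0 := fun l h hl => by rw [hf]; dsimp only; rw [if_neg hl]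
    have f1v : f lo h₁ = f₁ := by rw [fv, if_pos rfl]
    have f2v : f lo M = f₂ := by rw [fv, if_neg (Ne.symm hne), if_pos rfl]
    have f0v : ∀ h, h ≠ h₁ → h ≠ M → f lo h = 0 := fun h h1 h2 => by rw [fv, if_neg h1, if_neg h2]
    have colv : ∀ h, ∑ l ∈ Finset.range (M + 1), freeRate (a * x) T l h * f l h = freeRate (a * x) T lo h * f lo h := by
      intro h
      exact Finset.sum_eq_single_of_mem lo (Finset.mem_range.2 (by omega)) (fun l _ hl => by rw [fz l h hl, mul_zero])
    refine decAt_all_of_torqueCost (a * x) M (gate L a) T f hax0 hax1 g0 gM g1 gmean hT0 hta ?_ ?_ ?_ ?_ ?_ j' hj'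
    · intro l h; rw [hf]; dsimp only; split_ifs
      · exact hf₁
      · exact hf₂
      · exact le_rfl
      · exact le_rfl
    · intro l h hlh
      by_cases hl : l = lo
      · subst hl
        by_cases e1 : h = h₁
        · subst e1; rw [f1v] at hlh
          exact ⟨hlo, hT2, by omega, by omega, hcomp₁ hlh⟩
        · by_cases e2 : h = M
          · subst e2
            exact ⟨hlo, hT2, by omega, le_rfl, by rw [cMR]; linarith⟩
          · rw [f0v h e1 e2] at hlh; exact absurd hlh (lt_irrefl _)
      · rw [fz l h hl] at hlh; exact absurd hlh (lt_irrefl _)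
    · intro l hl hlow
      by_cases hl' : l = lo
      · subst hl'
        rw [Finset.sum_eq_add_of_mem h₁ M (Finset.mem_range.2 (by omega)) (Finset.mem_range.2 (by omega)) hne
          (fun h _ hh => f0v h hh.1 hh.2), f1v, f2v, hsum]
      · rw [Finset.sum_eq_zero (fun h _ => fz l h hl'), lowz l hl hlow hl']
    · intro h _
      rw [colv h]
      by_cases e1 : h = h₁
      · subst e1; rw [f1v]; exact hcap₁
      · by_cases e2 : h = M
        · subst e2; rw [f2v]; exact hcap₂
        · rw [f0v h e1 e2, mul_zero]; exact g0 h
    · have hterm : ∀ h ∈ Finset.range (M + 1), h ≠ h₁ → h ≠ M →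
          (if T < (h : ℝ) then ((h : ℝ) - T) * ∑ l ∈ Finset.range (M + 1), freeRate (a * x) T l h * f l h else 0) = 0 := by
        intro h _ h1 h2; rw [colv h, f0v h h1 h2, mul_zero, mul_zero, ite_self]
      rw [Finset.sum_eq_add_of_mem h₁ M (Finset.mem_range.2 (by omega)) (Finset.mem_range.2 (by omega)) hne
        (fun h hh hne' => hterm h hh hne'.1 hne'.2), colv h₁, colv M, f1v, f2v, if_pos (show T < ((M : ℕ) : ℝ) by rw [cMR]; exact hTtop)]
      exact hcost
  · -- no positive low atom
    refine decAt_all_of_lowCeiling (a * x) (2 * lo + 2 * K) (gate L a) T hax0 hax1 g0 gM g1 gmean hT0 hta ?_ j' hj'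
    intro l hl hlow hpos
    exfalso
    have hne : l ≠ lo := by
      intro h; subst h; exact hT2 (by linarith)
    exact hpos.ne' (lowz l hl hlow hne)


end LawDec
end Quant
end Summit.CriticalPhenomena.PercolationContinuityZ3.Theorems
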